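import Mathlib.LinearAlgebra.Lagrange
import Mathlib.Algebra.MvPolynomial.Degrees
import Mathlib.Algebra.Polynomial.BigOperators
import Mathlib.RingTheory.MvPolynomial.Basic
import Mathlib.Data.Real.Basic
import Mathlib.Tactic.Positivity
import Mathlib.Tactic.Linarith
import HarnessLib

/-!
# Self-correction of low-degree polynomials along random lines (the Reed–Muller local corrector)

Literature / complexity — the combinatorial core of "low-degree polynomials are random self-reducible /
self-correctible" (Beaver–Feigenbaum, Lipton; Arora–Barak 2009, §8.6.2 and §19.4.2: "to recover `P(x)`
pick a random line through `x`, query the received word on `d + 1` points of the line and interpolate"),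
which is the self-correctibility half of Trevisan–Vadhan's `PSPACE`-complete problem (Comput. Complexity 16
(2007), §3 "self-correctible", §4 Thm. 4.3: "The self-correctibility follows from the fact that each `f_{n,i}`
is a multivariate polynomial of total degree at most `poly(n)`"). Over an arbitrary field `F`, for a
polynomial `p` (any finite set of variables `σ`) of total degree `≤ d` and any "received word" `g : F^σ → F`:

* `LineCorrect.lineRestrict p x y` — `t ↦ p(x + t·y)` as a univariate polynomial; `eval_lineRestrict`,
  **`natDegree_lineRestrict_le`** (`≤ totalDegree p`);
* `LineCorrect.correctVal τ g x y` — interpolate `g` at the `d + 1` points `x + τᵢ·y` of the line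
  (distinct nonzero nodes `τ`) and read the value at `t = 0`; **`correctVal_eq`** — if `g` is right at the
  `d + 1` query points then the corrected value is `p(x)` (Lagrange, `Lagrange.eq_interpolate_of_eval_eq`);
* `card_badDirections_le` — for every set `Bad` of points and every `x`, at most `(d+1)·|Bad|` directions
  `y` put a query point in `Bad` (each `y ↦ x + τᵢ·y`, `τᵢ ≠ 0`, is injective);
* **`card_wrongDirections_le`** — hence the corrector errs at `x` for at most `(d+1)·#{z | g z ≠ p z}`
  directions `y`: with `g` wrong on a `δ` fraction of `F^σ`, a uniformly random direction fails with
  probability `≤ (d+1)δ` (`wrongFraction_le`), for EVERY `x`.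

Everything is proved; the two definitions are the line restriction and the corrected value (no machines,
no named facts). The tree's `WorstCaseToMild.lean` proves the same decoding step in CIRCUIT form for the
specific subcube extension over `GF(2^{M+1})`; this file is the field-generic counting statement that a
randomized (uniform) self-corrector consumes.

## References

* [AroraBarakCC2009] S. Arora, B. Barak, *Computational Complexity: A Modern Approach*, CUP 2009, §8.6.2
  (random self-reducibility via lines), §19.4.2 (Reed–Muller local decoder: random line, `d + 1` queries,
  interpolation).
* [TrevisanVadhan2007] L. Trevisan, S. Vadhan, Comput. Complexity 16 (2007), §3 (self-correctible functions)
  and §4, Thm. 4.3.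
* D. Beaver, J. Feigenbaum, *Hiding instances in multioracle queries*, STACS 1990; R. Lipton, *New directions
  in testing*, DIMACS 1991 (random self-reducibility of low-degree polynomials).
-/

noncomputable section

namespace Literature.Computability.Complexity

namespace LineCorrect

open MvPolynomial Finset

variable {F : Type*} [Field F] {σ : Type*}

/-! ### Restriction to a line -/

/-- **The restriction of `p` to the line `t ↦ x + t·y`**, as a univariate polynomial in `t`.
[cite: AroraBarakCC2009, §19.4.2] -/
def lineRestrict (p : MvPolynomial σ F) (x y : σ → F) : Polynomial F :=
  MvPolynomial.aeval (fun i => Polynomial.C (x i) + Polynomial.C (y i) * Polynomial.X) p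

/-- **Value of the restriction**: `(p|_{x,y})(t) = p(x + t·y)`. [cite: AroraBarakCC2009, §19.4.2] -/
theorem eval_lineRestrict (p : MvPolynomial σ F) (x y : σ → F) (t : F) :
    (lineRestrict p x y).eval t = MvPolynomial.eval (x + t • y) p := by
  unfold lineRestrict
  rw [← Polynomial.coe_aeval_eq_eval]
  change ((Polynomial.aeval t).comp (MvPolynomial.aeval _)) p = _
  rw [MvPolynomial.comp_aeval]
  show _ = MvPolynomial.aeval (R := F) (x + t • y) p
  refine congrArg (fun f : σ → F => MvPolynomial.aeval f p) (funext fun i => ?_)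
  simp only [map_add, map_mul, Polynomial.aeval_C, Polynomial.aeval_X, Pi.add_apply, Pi.smul_apply,
    smul_eq_mul, Algebra.algebraMap_self, RingHom.id_apply]
  ring

/-- The images of the variables are affine in `t`: degree `≤ 1`. [folklore] -/
theorem natDegree_affine_le (a b : F) : (Polynomial.C a + Polynomial.C b * Polynomial.X).natDegree ≤ 1 := by
  refine (Polynomial.natDegree_add_le _ _).trans (max_le ?_ ?_)
  · rw [Polynomial.natDegree_C]; exact Nat.zero_le _
  · exact (Polynomial.natDegree_C_mul_le _ _).trans Polynomial.natDegree_X_le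

/-- **The restriction to a line has degree at most the total degree.** [cite: AroraBarakCC2009, §19.4.2 ("a univariate polynomial of degree at most `d`")] -/
theorem natDegree_lineRestrict_le (p : MvPolynomial σ F) (x y : σ → F) :
    (lineRestrict p x y).natDegree ≤ p.totalDegree := by
  classical
  unfold lineRestrict
  conv_lhs => rw [p.as_sum, map_sum]
  refine Polynomial.natDegree_sum_le_of_forall_le _ _ fun s hs => ?_
  rw [MvPolynomial.aeval_monomial, Finsupp.prod]
  refine (Polynomial.natDegree_mul_le).trans ?_
  have h1 : (algebraMap F (Polynomial F) (coeff s p)).natDegree = 0 := by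
    rw [Polynomial.algebraMap_eq, Polynomial.natDegree_C]
  rw [h1, zero_add]
  refine (Polynomial.natDegree_prod_le _ _).trans ?_
  calc ∑ i ∈ s.support, ((Polynomial.C (x i) + Polynomial.C (y i) * Polynomial.X) ^ s i).natDegree
      ≤ ∑ i ∈ s.support, s i := by
        refine Finset.sum_le_sum fun i _ => ?_
        refine Polynomial.natDegree_pow_le.trans ?_
        calc s i * (Polynomial.C (x i) + Polynomial.C (y i) * Polynomial.X).natDegree ≤ s i * 1 :=
              Nat.mul_le_mul_left _ (natDegree_affine_le _ _)
          _ = s i := mul_one _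
    _ = s.sum fun _ e => e := rfl
    _ ≤ p.totalDegree := le_totalDegree hs

/-! ### Interpolation on the line -/

variable {d : ℕ} (τ : Fin (d + 1) → F)

/-- **The corrected value at `x` along direction `y`**: interpolate the received word `g` at the `d + 1`
query points `x + τᵢ·y` and evaluate at `t = 0`. [cite: AroraBarakCC2009, §19.4.2] -/
def correctVal (g : (σ → F) → F) (x y : σ → F) : F :=
  (Lagrange.interpolate Finset.univ τ fun i => g (x + τ i • y)).eval 0

/-- **If the received word is right at the query points, the corrected value is `p(x)`** (the restriction
to the line has degree `≤ d < d + 1 =` number of nodes, so it IS the interpolant).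
[cite: AroraBarakCC2009, §19.4.2] -/
theorem correctVal_eq (hτ : Function.Injective τ) (p : MvPolynomial σ F) (hd : p.totalDegree ≤ d)
    (g : (σ → F) → F) (x y : σ → F)
    (hgood : ∀ i, g (x + τ i • y) = MvPolynomial.eval (x + τ i • y) p) :
    correctVal τ g x y = MvPolynomial.eval x p := by
  classical
  have hdeg : (lineRestrict p x y).degree < #(Finset.univ : Finset (Fin (d + 1))) := by
    rw [Finset.card_univ, Fintype.card_fin]
    refine lt_of_le_of_lt Polynomial.degree_le_natDegree ?_
    exact WithBot.coe_lt_coe.2 (Nat.lt_succ_of_le ((natDegree_lineRestrict_le p x y).trans hd))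
  have hinj : Set.InjOn τ (Finset.univ : Finset (Fin (d + 1))) := hτ.injOn
  have heq := Lagrange.eq_interpolate_of_eval_eq (r := fun i => g (x + τ i • y)) hinj hdeg
    (fun i _ => by rw [eval_lineRestrict, hgood i])
  unfold correctVal
  rw [← heq, eval_lineRestrict, zero_smul, add_zero]

/-! ### Few directions meet a small bad set -/

/-- **At most `(d+1)·|Bad|` directions put a query point into `Bad`** (for nonzero nodes, each
`y ↦ x + τᵢ·y` is injective). [cite: AroraBarakCC2009, §19.4.2 ("each query point is uniformly distributed")] -/
theorem card_badDirections_le [Fintype F] [DecidableEq F] [Fintype σ] [DecidableEq σ] (Bad : Finset (σ → F)) (x : σ → F)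
    (hτ0 : ∀ i, τ i ≠ 0) :
    #{y : σ → F | ∃ i, x + τ i • y ∈ Bad} ≤ (d + 1) * #Bad := by
  classical
  calc #{y : σ → F | ∃ i, x + τ i • y ∈ Bad}
      ≤ #((Finset.univ : Finset (Fin (d + 1))).biUnion fun i => {y : σ → F | x + τ i • y ∈ Bad}) := by
        refine Finset.card_le_card fun y hy => ?_
        rw [Finset.mem_filter] at hy
        obtain ⟨i, hi⟩ := hy.2
        exact Finset.mem_biUnion.2 ⟨i, Finset.mem_univ _, by rw [Finset.mem_filter]; exact ⟨Finset.mem_univ _, hi⟩⟩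
    _ ≤ ∑ i : Fin (d + 1), #{y : σ → F | x + τ i • y ∈ Bad} := Finset.card_biUnion_le
    _ ≤ ∑ _i : Fin (d + 1), #Bad := by
        refine Finset.sum_le_sum fun i _ => ?_
        refine Finset.card_le_card_of_injOn (fun y => x + τ i • y) (fun y hy => ?_) ?_
        · exact (Finset.mem_filter.1 hy).2
        · intro y₁ _ y₂ _ h
          have h' : τ i • y₁ = τ i • y₂ := add_left_cancel h
          exact smul_right_injective _ (hτ0 i) h'
    _ = (d + 1) * #Bad := by simp

/-- **The corrector errs at `x` for at most `(d+1) · #{z | g z ≠ p z}` directions.**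
[cite: AroraBarakCC2009, §19.4.2] [cite: TrevisanVadhan2007, §3 (self-correctible functions)] -/
theorem card_wrongDirections_le [Fintype F] [DecidableEq F] [Fintype σ] [DecidableEq σ] (hτ : Function.Injective τ) (hτ0 : ∀ i, τ i ≠ 0)
    (p : MvPolynomial σ F) (hd : p.totalDegree ≤ d) (g : (σ → F) → F) (x : σ → F) :
    #{y : σ → F | correctVal τ g x y ≠ MvPolynomial.eval x p} ≤
      (d + 1) * #{z : σ → F | g z ≠ MvPolynomial.eval z p} := by
  classical
  refine le_trans (Finset.card_le_card fun y hy => ?_) (card_badDirections_le τ _ x hτ0)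
  rw [Finset.mem_filter] at hy ⊢
  refine ⟨Finset.mem_univ _, ?_⟩
  by_contra hall
  push Not at hall
  refine hy.2 (correctVal_eq τ hτ p hd g x y fun i => ?_)
  by_contra hne
  exact hall i (by rw [Finset.mem_filter]; exact ⟨Finset.mem_univ _, hne⟩)

/-- **Probability form**: if `g` disagrees with `p` on at most a `δ` fraction of `F^σ`, then for every `x`
a uniformly random direction makes the corrector err with probability `≤ (d+1)δ`.
[cite: AroraBarakCC2009, §19.4.2] [cite: TrevisanVadhan2007, §3 (self-correctible functions)] -/
theorem wrongFraction_le [Fintype F] [DecidableEq F] [Fintype σ] [DecidableEq σ] (hτ : Function.Injective τ) (hτ0 : ∀ i, τ i ≠ 0)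
    (p : MvPolynomial σ F) (hd : p.totalDegree ≤ d) (g : (σ → F) → F) {δ : ℝ}
    (hg : (#{z : σ → F | g z ≠ MvPolynomial.eval z p} : ℝ) ≤ δ * Fintype.card (σ → F)) (x : σ → F) :
    (#{y : σ → F | correctVal τ g x y ≠ MvPolynomial.eval x p} : ℝ) ≤
      (d + 1) * δ * Fintype.card (σ → F) := by
  have h := card_wrongDirections_le τ hτ hτ0 p hd g x
  have h' : (#{y : σ → F | correctVal τ g x y ≠ MvPolynomial.eval x p} : ℝ) ≤
      (d + 1) * (#{z : σ → F | g z ≠ MvPolynomial.eval z p} : ℝ) := by exact_mod_cast h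
  refine h'.trans ?_
  have hd0 : (0 : ℝ) ≤ d + 1 := by positivity
  nlinarith

end LineCorrect

end Literature.Computability.Complexity

end
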